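import Summits.QuantumFields.BalabanUV.T4Continuum.Support.B16HistoryStepJunction
import Summits.QuantumFields.BalabanUV.T4Continuum.Support.HistoryBankingRoundingUnrounded
import Summits.QuantumFields.BalabanUV.T4Continuum.Support.CountThresholdUniform
import Literature.MathematicalPhysics.QuantumFieldTheory.Balaban1983to89.T4CanonicalMenus
import Summits.QuantumFields.BalabanUV.T4Continuum.Spine.NE7c.LiveFactorStepFactors

/-!
# `T4Continuum.Spine.NE7c.LiveFactorEndLetters` — spine estimate NE7c (node U5b), road (δ) THRESHOLD RANDOMISATION:
# the lowered-threshold run IN THE LETTERS OF THE NE7b LINEAGE's END AT THE TOWER (IR-101-1) and of its step junction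
# J4 (`B16HistoryStepJunction`, IR-100-3) — the (L1-step) reading costs ONE moved letter `γ₀ ↦ λ₀²γ₀`
# (cell `pub-balaban-gaps`, track G2, seat ne8 gen 6; record `HOME/ne/NE7c.md` §13)

HONEST FRAMING.  Finite four-torus programme, rung (B)+1 only — NOT infinite volume, NOT a mass gap, NOT the Clay
problem, NOT summit progress, NOT a proof of NE7c (`T4IndicatorShell.ShellWeightBound`, INSTANCE 0∕1, which waits on
node O ∕ the (α)-instance) and NOT a proof of NE7b (`T4WeightBudget.RelWeightBound`, NOT PRINTED, NOT PROVED).  Nothing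
of [Bałaban 1983–89] is asserted beyond print: every object below is a LETTER of the NE7b lineage (`sBsharp`, `sRunr`,
J4's `sBsharp`∕`sRsharp`, `T4PrintedShapeBanking.Consts`, `PrintedO1s`), a HYPOTHESIS SHAPE of the tree
(`StepDisplaysAt`, `HwPinned`, `ThresholdOK`) or J4's landed junction `hwPinned_of_stepDisplaysAt` (p345667) cited BY
NAME; what is PROVED is real arithmetic (`ring`, one multiplication by `λ₀² ≥ 0`) plus instantiation.  This file does
NOT build a tower record for the lowered-threshold run (node O's, exactly as for print's run), does NOT import or consume
the END's records (`TowerReadDataLWL` p345321 — its renewal pin `S_h` is being ♭-re-cut to print's ROUNDED letter by the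
owner, RULING45, parts 1R p347096 ∕ 2R–3R staged — nor part 3's `hw_of_stepDisplays*`, «DO NOT CONSUME»), and does NOT
verify census completeness (NOT PRINTED).  Spine PROVED 0∕9 — unchanged.

CONTENT.  Road (δ) randomises the large-field thresholds of ONE run over `λ ∈ [λ₀, 1]`; (L1-step) = every printed
estimate survives thresholds lowered by `λ₀` at the cost of «g smaller» (files 1–6).  File 6 (`LiveFactorStepFactors`,
p345943) put the live step sentences into `StepDisplaysAt` at live letters; since then the NE7b lineage landed J4 (the
sentences at the process carriers ⟹ `HwPinned`, PARAMETRIC in `c : B16StepFactorsPrinted.Consts`) and the END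
(`TowerReadData… D C O θv …` for all small couplings ⟹ `ContinuumYM4Torus D`, PARAMETRIC in `C`, `O`).  Here:
* §1 LETTERS.  In the END's `PrintedO1s` the live run moves ONE letter `γ₀ ↦ λ₀²γ₀`: the birth floor `sBsharp O m C g j d′
  = γ₀·m·p₀(g_j)²·(d′+1)` scales by `λ₀²` (`sBsharp_live`); print's UNROUNDED case-2 renewal exponent `S_h = sRunr …
  = ½γ₀W_h⁻¹A₁²ℓ_h^{2p₁}` scales by `λ₀²` whether one charges `γ₀` or the threshold amplitude `A₁ ↦ λ₀A₁` (`sRunr_live`,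
  `sRunr_live_threshold` — the two readings agree); print's ROUNDED renewal letter `R_h^{−(d+5)}ℓ_h^{2p₁}` (the END's pin
  of record after RULING45; J4's `sRsharp`) does not see `γ₀` at all (`junction_sRsharp_live₁` is `rfl`).  J4's letters at
  file 6's two-letter live `c` are `λ₀²`-times J4's (`junction_sBsharp_live`, `junction_sRsharp_live`).
* §2 THE END's CONSTANTS-SIDE HYPOTHESES AT LIVE LETTERS.  The count's quadratic birth constant `C.a` («print's ½γ₀A₁²»)
  and the slacks `θ, θv` of `hslack : C.a + (θ + θv) ≤ ½γ₀A₁²` move with `γ₀`: `ThresholdOK` survives (`thresholdOK_live`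
  — its only `a`-clause is `0 < a`), the slack survives (`slack_live`), `birthMass` and `μ, κ₁, E₀, A₀, n₁, E₂, E₃` do
  not see `a` (`birthMass_live` is `rfl`); the END's gaps `1 ≤ η, η′, κ, …, p₀` are letter-free, and every «g small» the
  END itself needs (rounding window, `irThresholdM ∝ 1∕(a·A₀)`) is produced INSIDE the END from `ForSmallCouplings` at
  whatever letters it is handed.  So the END's theorem at the live letters is ONE instantiation (`O ↦ {O with γ₀ :=
  λ₀²γ₀}`, `C ↦ {C with a := λ₀²a}`, `θ ↦ λ₀²θ`) — recorded in `HOME/ne/NE7c.md` §13 against the ♭-re-cut record, not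
  typed here while the re-cut is in flight.
* §3 J4 AT LIVE LETTERS (gen-5 hand-off trigger (iii)).  At file 6's two-letter `c`: `HwPinned` at `λ₀²`-times J4's
  two letters (`hwPinned_live_of_stepDisplaysAt`).  At the ONE-LETTER `c` the END's tables want (`c.P1` amplitude-free,
  `c.γ₀ = O.γ₀`): `HwPinned T 𝒮 (λ₀²·sBsharp D c) (sRsharp D c) …` — print's ROUNDED renewal letter survives the live
  factor ENTIRELY (`hwPinned_live_oneLetter_of_stepDisplaysAt`); its input `StepDisplaysAt … {c with γ₀ := λ₀²γ₀}` is
  (F) by monotonicity and the rounded (P) at the UNCHANGED profile by print's own per-case roundings of the preparatory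
  factors read at live amplitudes («g_j ≤ g⋆(λ₀)») — the companion file 8 `LiveFactorRoundedRenewal`.

NET (honest).  (L1-step) in the END's letters = one moved letter; the price sits inside «g sufficiently small», where
files 1–6 located it.  Open and NOT this file's: node O, the END's ♭-re-cut, census completeness, D-δ*.  VERDICT of
`HOME/ne/NE7c.md` UNCHANGED: WORK-bound behind node O.  HONEST DEPENDENCY (cell): continuum YM on T⁴ ⇐ BetaPertH ∧ nine
spine estimates (0∕9 proved); BetaPertH ⇐ (D1) ∧ (D4) ∧ CAP+tail.  This file changes none of it.
-/

open Literature.MathematicalPhysics.QuantumFieldTheory.Balaban1983to89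
open Literature.MathematicalPhysics.QuantumFieldTheory.Balaban1983to89.B16StepFactorsPrinted
open Literature.MathematicalPhysics.QuantumFieldTheory.Balaban1983to89.B16LargeFieldFactors380 (minConst)
open T4PrintedShapeBanking T4CanonicalMenus T4Continuum
open Summit.QuantumFields.BalabanUV.T4Continuum.HistoryConstants
open Summit.QuantumFields.BalabanUV.T4Continuum.CountThresholdUniform
open Summit.QuantumFields.BalabanUV.T4Continuum.HistoryBankingSharpShares
open Summit.QuantumFields.BalabanUV.T4Continuum.HistoryBankingRoundingUnrounded
open Summit.QuantumFields.BalabanUV.T4Continuum.B16HistoryIndexedRepr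
open Summit.QuantumFields.BalabanUV.T4Continuum.B16HistoryReprChain
open Summit.QuantumFields.BalabanUV.T4Continuum.B16HistoryReprInstance
open Summit.QuantumFields.BalabanUV.T4Continuum.B16HistoryReprReadCausal
open Summit.QuantumFields.BalabanUV.T4Continuum.B16HistoryStepDisplayPinned
open Summit.QuantumFields.BalabanUV.T4Continuum.B16HistoryStepJunction
open Summit.QuantumFields.BalabanUV.T4Continuum.Spine.NE7c.LiveFactorStepFactors

namespace Summit.QuantumFields.BalabanUV.T4Continuum.Spine.NE7c.LiveFactorEndLetters

noncomputable section

/-! ## §1. Letter identities: the live run moves ONE letter of the END, `γ₀ ↦ λ₀²γ₀` -/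

section Letters

variable {lam₀ : ℝ}

/-- **THE BIRTH FLOOR AT THE LIVE LETTER**: `sBsharp {O with γ₀ := λ₀²γ₀} m C g j d′ = λ₀² · sBsharp O m C g j d′`
(`sBsharp = γ₀·m·p₀(g_j)²·(d′+1)`, the END record's floor `hsB`). [folklore] -/
theorem sBsharp_live (O : PrintedO1s) (m : ℝ) (C : T4PrintedShapeBanking.Consts) (g : ℕ → ℝ) (j d' : ℕ) :
    HistoryBankingSharpShares.sBsharp { O with γ₀ := lam₀ ^ 2 * O.γ₀ } m C g j d' =
      lam₀ ^ 2 * HistoryBankingSharpShares.sBsharp O m C g j d' := by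
  unfold HistoryBankingSharpShares.sBsharp
  ring

/-- **PRINT's UNROUNDED RENEWAL EXPONENT AT THE LIVE LETTER** (charging `γ₀`):
`sRunr (λ₀²γ₀) A₁ M Lr β₀ d p₁ R g h = λ₀² · sRunr γ₀ A₁ M Lr β₀ d p₁ R g h` (`S_h = ½γ₀·W_h⁻¹·A₁²·(ℓ_h^{p₁})²`). [folklore] -/
theorem sRunr_live (γ₀ A₁ M Lr β₀ : ℝ) (d p₁ : ℕ) (R : ℕ → ℕ) (g : ℕ → ℝ) (h : ℕ) :
    sRunr (lam₀ ^ 2 * γ₀) A₁ M Lr β₀ d p₁ R g h = lam₀ ^ 2 * sRunr γ₀ A₁ M Lr β₀ d p₁ R g h := by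
  unfold sRunr
  ring

/-- **… AT THE LIVE THRESHOLD** (charging the threshold amplitude `A₁ ↦ λ₀A₁`, the reading of files 1–5): the SAME
letter — `S_h` sees the product `γ₀A₁²` only, so the two readings of the live run agree. [folklore] -/
theorem sRunr_live_threshold (γ₀ A₁ M Lr β₀ : ℝ) (d p₁ : ℕ) (R : ℕ → ℕ) (g : ℕ → ℝ) (h : ℕ) :
    sRunr γ₀ (lam₀ * A₁) M Lr β₀ d p₁ R g h = lam₀ ^ 2 * sRunr γ₀ A₁ M Lr β₀ d p₁ R g h := by
  unfold sRunr
  ring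

/-- **J4's SHARP BIRTH LETTER AT FILE 6's LIVE LETTERS** is `λ₀²`-times J4's at `c`
(`sBsharp D c K ℓ d′ = γ₀·min{…}·p₀(g^K_ℓ)²·(d′+1)`). [folklore] -/
theorem junction_sBsharp_live (D : ℕ → B16.RunData) (c : B16StepFactorsPrinted.Consts) :
    B16HistoryStepJunction.sBsharp D { c with γ₀ := lam₀ ^ 2 * c.γ₀, P1 := fun g => lam₀ * c.P1 g } =
      fun K ℓ d' => lam₀ ^ 2 * B16HistoryStepJunction.sBsharp D c K ℓ d' := by
  funext K ℓ d'
  unfold B16HistoryStepJunction.sBsharp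
  simp only
  ring

/-- **J4's ROUNDED RENEWAL LETTER AT FILE 6's LIVE LETTERS** is `λ₀²`-times J4's at `c`
(`sRsharp D c K h = R(g^K_h)^{−(d+5)}·p₁(g^K_h)²`, the profile `P1 ↦ λ₀·P1`). [folklore] -/
theorem junction_sRsharp_live (D : ℕ → B16.RunData) (c : B16StepFactorsPrinted.Consts) :
    B16HistoryStepJunction.sRsharp D { c with γ₀ := lam₀ ^ 2 * c.γ₀, P1 := fun g => lam₀ * c.P1 g } =
      fun K h => lam₀ ^ 2 * B16HistoryStepJunction.sRsharp D c K h := by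
  funext K h
  unfold B16HistoryStepJunction.sRsharp
  simp only
  ring

end Letters

/-! ## §2. The END's constants-side hypotheses at the live letters -/

section Constants

variable {lam₀ : ℝ}

/-- moving `a` keeps the count's symbolic constants valid (`Consts.Valid` does not mention `a`) [folklore] -/
theorem valid_live {C : T4PrintedShapeBanking.Consts} (h : C.Valid) :
    ({ C with a := lam₀ ^ 2 * C.a } : T4PrintedShapeBanking.Consts).Valid :=
  ⟨h.E₂_nonneg, h.E₃_nonneg, h.κ₁_nonneg, h.E₀_nonneg, h.Eb_nonneg, h.μ_nonneg, h.dC_le⟩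

/-- **`ThresholdOK` AT THE LIVE CONSTANT**: its only `a`-clause is `0 < a`, and `0 < λ₀²a` for `λ₀ > 0`. [folklore] -/
theorem thresholdOK_live (h0 : 0 < lam₀) {C : T4PrintedShapeBanking.Consts} {L r : ℕ} {β₀ : ℝ}
    (h : ThresholdOK C L r β₀) : ThresholdOK { C with a := lam₀ ^ 2 * C.a } L r β₀ :=
  ⟨valid_live h.valid, mul_pos (pow_pos h0 2) h.a_pos, h.A₀_pos, h.one_le_L, h.β₀_nonneg, h.rq_lt⟩

/-- the birth mass `e^{−Eb}·e^{−μ}∕(1 − e^{−μ})` does not see `a` [folklore] -/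
theorem birthMass_live (C : T4PrintedShapeBanking.Consts) : birthMass { C with a := lam₀ ^ 2 * C.a } = birthMass C :=
  rfl

/-- **THE SLACK INEQUALITY AT THE LIVE LETTERS**: print's `C.a + (θ + θv) ≤ ½γ₀A₁²` gives
`λ₀²a + (λ₀²θ + λ₀²θv) ≤ ½(λ₀²γ₀)A₁²` — the END's `hslack` for the live record's letters. [folklore] -/
theorem slack_live (C : T4PrintedShapeBanking.Consts) (O : PrintedO1s) {θ θv : ℝ}
    (h : C.a + (θ + θv) ≤ O.γ₀ * O.A₁ ^ 2 / 2) :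
    ({ C with a := lam₀ ^ 2 * C.a } : T4PrintedShapeBanking.Consts).a + (lam₀ ^ 2 * θ + lam₀ ^ 2 * θv) ≤
      ({ O with γ₀ := lam₀ ^ 2 * O.γ₀ } : PrintedO1s).γ₀ * O.A₁ ^ 2 / 2 := by
  show lam₀ ^ 2 * C.a + (lam₀ ^ 2 * θ + lam₀ ^ 2 * θv) ≤ lam₀ ^ 2 * O.γ₀ * O.A₁ ^ 2 / 2
  nlinarith [mul_le_mul_of_nonneg_left h (sq_nonneg lam₀)]

/-- the live slack is positive when print's is [folklore] -/
theorem slack_pos_live (h0 : 0 < lam₀) {θ : ℝ} (hθ : 0 < θ) : 0 < lam₀ ^ 2 * θ := mul_pos (pow_pos h0 2) hθ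

end Constants

/-! ## §3. J4 at the live letters: the live run's pinned per-step display -/

section Junction

variable {P : Type} {d : ℕ} {C : ℕ → ℕ → Type} {𝒢 : (K j : ℕ) → GoodClass (C K j)}
  (T : (K : ℕ) → Tower P (C K) (𝒢 K)) (𝒮 : StepReading P d) (D : ℕ → B16.RunData) (c : B16StepFactorsPrinted.Consts)
  (X : (K j : ℕ) → (Fin j → P) → StepData d P) (cΛ M : ℝ) (gs : ℕ → ℕ → ℝ) {lam₀ : ℝ}

/-- **J4 AT FILE 6's LIVE LETTERS** (gen-5 hand-off trigger (iii)): the LIVE step sentences at the carriers read off the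
tower and the process (`StepDisplaysAt … {c with γ₀ := λ₀²γ₀, P1 := λ₀·P1}`, inhabited by file 6's `stepDisplaysAt_live`)
+ J4's `=` class junction and volume domination ⟹ the live run's PINNED PER-STEP DISPLAY at `λ₀²`-TIMES J4's SHARP
LETTERS.  = `hwPinned_of_stepDisplaysAt` at the live `c`, re-lettered by §1; the three inputs are displayed. [folklore] -/
theorem hwPinned_live_of_stepDisplaysAt {K₀ : ℕ} (hc : 0 ≤ cΛ) (hM : 0 ≤ M) (hℓ : ∀ K j, j ≤ K → 0 ≤ ell (gs K) j)
    (hdisp : ∀ K, K₀ ≤ K → ∀ (j : ℕ) (g : Fin j → P),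
      StepDisplaysAt (D K) j (carriersOf T 𝒮 (D K) K j g (X K j g))
        { c with γ₀ := lam₀ ^ 2 * c.γ₀, P1 := fun g => lam₀ * c.P1 g })
    (hclass : ∀ K, K₀ ≤ K → ∀ (j : ℕ) (g : Fin j → P) (p : P),
      ∀ x ∈ (𝒮.runPartial K (j + 1) (Fin.snoc g p)).histM.newPairs (j + 1),
        (X K j g).dC p x = (𝒮.κ K ((𝒮.runPartial K (j + 1) (Fin.snoc g p)).histM.newAt (j + 1) x) : ℝ))
    (hvol : ∀ K, K₀ ≤ K → ∀ (j : ℕ) (g : Fin j → P) (p : P),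
      (X K j g).gInt p * (X K j g).aInt p * (X K j g).vfac p ≤
        ∏ cc ∈ (𝒮.runPartial K (j + 1) (Fin.snoc g p)).histM.comp (j + 1), ΛexpL cΛ M d gs 𝒮.R K (j + 1) ^ (cc.2).card) :
    HwPinned T 𝒮 (fun K ℓ d' => lam₀ ^ 2 * B16HistoryStepJunction.sBsharp D c K ℓ d')
      (fun K h => lam₀ ^ 2 * B16HistoryStepJunction.sRsharp D c K h) cΛ M gs K₀ := by
  have h := hwPinned_of_stepDisplaysAt T 𝒮 D { c with γ₀ := lam₀ ^ 2 * c.γ₀, P1 := fun g => lam₀ * c.P1 g } X cΛ M gs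
    hc hM hℓ hdisp hclass hvol
  rw [junction_sBsharp_live, junction_sRsharp_live] at h
  exact h

/-- J4's sharp birth letter at the ONE-LETTER live `c` (`γ₀ ↦ λ₀²γ₀` alone) is `λ₀²`-times J4's at `c` [folklore] -/
theorem junction_sBsharp_live₁ :
    B16HistoryStepJunction.sBsharp D { c with γ₀ := lam₀ ^ 2 * c.γ₀ } =
      fun K ℓ d' => lam₀ ^ 2 * B16HistoryStepJunction.sBsharp D c K ℓ d' := by
  funext K ℓ d'
  unfold B16HistoryStepJunction.sBsharp
  simp only
  ring

/-- J4's ROUNDED renewal letter `R(g_h)^{−(d+5)}·p₁(g_h)²` does not see `γ₀`: at the one-letter live `c` it is J4's at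
`c`, UNCHANGED — as is the END's renewal pin of record after the owner's ♭-re-cut (`sRrnd`, RULING45). [folklore] -/
theorem junction_sRsharp_live₁ :
    B16HistoryStepJunction.sRsharp D { c with γ₀ := lam₀ ^ 2 * c.γ₀ } = B16HistoryStepJunction.sRsharp D c :=
  rfl

/-- **J4 AT THE ONE-LETTER LIVE `c`** (the END-compatible convention: `c.P1` amplitude-free, `c.γ₀ = O.γ₀` moved together).
If the live step sentences hold at the process carriers in the form `StepDisplaysAt … {c with γ₀ := λ₀²γ₀}` — (F) by
monotonicity, the ROUNDED (P) at the UNCHANGED profile by print's own per-case roundings of the preparatory factors read at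
the live amplitudes («g_j small», `λ₀`-dependent; companion file 8) —, then with J4's `=` class junction and volume side
`HwPinned T 𝒮 (λ₀²·sBsharp D c) (sRsharp D c) cΛ M gs K₀`: the birth letter scaled, print's ROUNDED renewal letter surviving
the live factor ENTIRELY (gen 2's `liveFactor383_of_g_small` in J4's currency). [folklore] -/
theorem hwPinned_live_oneLetter_of_stepDisplaysAt {K₀ : ℕ} (hc : 0 ≤ cΛ) (hM : 0 ≤ M)
    (hℓ : ∀ K j, j ≤ K → 0 ≤ ell (gs K) j)
    (hdisp : ∀ K, K₀ ≤ K → ∀ (j : ℕ) (g : Fin j → P),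
      StepDisplaysAt (D K) j (carriersOf T 𝒮 (D K) K j g (X K j g)) { c with γ₀ := lam₀ ^ 2 * c.γ₀ })
    (hclass : ∀ K, K₀ ≤ K → ∀ (j : ℕ) (g : Fin j → P) (p : P),
      ∀ x ∈ (𝒮.runPartial K (j + 1) (Fin.snoc g p)).histM.newPairs (j + 1),
        (X K j g).dC p x = (𝒮.κ K ((𝒮.runPartial K (j + 1) (Fin.snoc g p)).histM.newAt (j + 1) x) : ℝ))
    (hvol : ∀ K, K₀ ≤ K → ∀ (j : ℕ) (g : Fin j → P) (p : P),
      (X K j g).gInt p * (X K j g).aInt p * (X K j g).vfac p ≤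
        ∏ cc ∈ (𝒮.runPartial K (j + 1) (Fin.snoc g p)).histM.comp (j + 1), ΛexpL cΛ M d gs 𝒮.R K (j + 1) ^ (cc.2).card) :
    HwPinned T 𝒮 (fun K ℓ d' => lam₀ ^ 2 * B16HistoryStepJunction.sBsharp D c K ℓ d')
      (B16HistoryStepJunction.sRsharp D c) cΛ M gs K₀ := by
  have h := hwPinned_of_stepDisplaysAt T 𝒮 D { c with γ₀ := lam₀ ^ 2 * c.γ₀ } X cΛ M gs hc hM hℓ hdisp hclass hvol
  rw [junction_sBsharp_live₁] at h
  exact h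

end Junction

end

end Summit.QuantumFields.BalabanUV.T4Continuum.Spine.NE7c.LiveFactorEndLetters
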